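import Literature.NumberTheory.Automorphic.AutomorphicInductionUnitaryCharacterCubic
import HarnessLib

/-!
# Automorphic induction of a unitary Hecke character through an arbitrary cubic extension: the
archimedean components (topic `NumberTheory/Automorphic`; named fact, D-0014)

Let `E/F` be a cubic extension of number fields, **not necessarily Galois**, and `θ` a unitary idèle
class character of `E`.  Jacquet, Piatetski-Shapiro and Shalika attach to `θ` — through their converse
theorem for `GL(3)` (*Automorphic forms on GL(3) II*, Ann. of Math. 109 (1979), §§13–14) — the
automorphic representation `π(θ) = ⊗_v π(Ind θ)_v` of `GL₃(𝔸_F)` (*Relèvement cubique non normal*,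
C. R. Acad. Sci. Paris 292 (1981) 567–571): its component at EVERY place `v` of `F`, archimedean places
included, is the local lift of the induced Weil-group representation `⊕_{w ∣ v} Ind_{W_{E_w}}^{W_{F_v}} θ_w`
(the converse theorem produces an automorphic representation with prescribed local components at all
places), and `π(θ)` is cuspidal when `θ` does not factor through `N_{E/F}`.  The tree's
`automorphicInduction_unitaryCharacter_cubic` (`AutomorphicInductionUnitaryCharacterCubic`) vendors the
unramified finite places of this theorem (Satake polynomials `∏_{w ∣ v} (X^{f(w|v)} - θ(ϖ_w))` at almost
every `v`) with its cuspidality clause, and explicitly declines the archimedean places.  Route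
`Langlands/PicardMuOrdinary` (item `ResidualAutomorphyEven`, stmt-Langlands-13760) induces an ALGEBRAIC
unitary Hecke character of regular infinity type on the CM sextic `K₃(ζ₃)` through the non-normal cubic
`K₃(ζ₃)/ℚ(ζ₃)` and needs the induced representation to be regular algebraic, i.e. the archimedean
component of `π(θ)`; this file vendors the cuspidality clause TOGETHER WITH THE ARCHIMEDEAN PLACES.

## The statement vendored (`automorphicInduction_unitaryCharacter_cubic_archimedean`)

For `E/F` of degree `3` (no Galois hypothesis), `θ` a unitary Hecke character of `E`, every proof `hF`
of the compactness fact typing the automorphic data of `GL₃(𝔸_F)`, and the cuspidality datum of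
`automorphicInduction_unitaryCharacter_cubic` (two places `w ≠ w'` of `E` above one place of `F`, of the
same residue degree, unramified for `θ`, with `θ(ϖ_w) ≠ θ(ϖ_{w'})`): there is a **cuspidal** `π` on
`GL₃(𝔸_F)` such that
1. (**unramified places**, verbatim clause (2) of the sibling) for almost every finite place `v` of `F`,
   `π` has a Satake parameter `α` at `v` with `∏_{a ∈ α} (X - a) = ∏_{w ∣ v} (X^{f(w|v)} - θ(ϖ_w))`;
2. (**archimedean places**) for every automorphic representation datum `τ` of `GL₁(𝔸_E)` with Satake
   parameter `{θ(ϖ_w)}` at almost every `w` and every archimedean parameter `χ` of `τ`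
   (`AutomorphicRepData.HasArchParameter`), `σ ↦ ∑_{σ' ∣ σ} χ(σ')` (sum over the embeddings
   `σ' : E → ℂ` extending `σ : F → ℂ`) is an archimedean parameter of `π`.
Clause 2 is stated in exactly the vocabulary of the hypothesis `hAI` of the tree's
`IsAutomorphicInductionAlong.archParameter_eq_sum_of_archAI_of_rigidity`
(`HenniartAutomorphicInductionAssembly`: "existence of automorphic induction with its archimedean
components"), here for `n = 1`, `d = 3` and no Galois hypothesis.

## Faithfulness notes

* *Rendering of the archimedean statement.*  The tree has no local components `π_v`; archimedean
  information of an automorphic representation datum is available only through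
  `AutomorphicRepData.HasArchParameter` (the restriction to `ℂ^× ≤ W_{F_v}` of the Langlands parameter of
  `π_v` at each embedding `σ` inducing `v`; Clozel 1990, §3.3).  For `π(θ)_v = π(⊕_{w ∣ v} Ind θ_w)` this
  restriction at `σ` is the direct sum, over the embeddings `σ' : E → ℂ` above `σ` (one for each pair
  `(w, embedding of E_w over σ)`), of the restrictions of `θ_w` — the shape `σ ↦ ∑_{σ' ∣ σ} χ(σ')` of
  Henniart 2012, §1.12 and `InfinityType.automorphicInduction`.  "The parameter of `θ` at `σ'`" is
  rendered as the archimedean parameter `χ` of ANY automorphic representation datum `τ` of `GL₁(𝔸_E)` with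
  the Satake parameters `{θ(ϖ_w)}` of `θ` at almost every `w` (Borel–Jacquet 1979, 4.6: such `τ` are the
  datum realisations of `θ`, e.g. `π_θ = ℂ·(θ∘det)/⊥` of `exists_automorphicRepData_detTwist_glOne`; two
  Hecke characters with the same values at almost all uniformizers are equal, and archimedean parameters
  are unique, `AutomorphicRepData.hasArchParameter_unique`); the clause is quantified over all such `τ`
  and `χ`, which is equivalent to asserting it for the unique parameter of one of them.  For ALGEBRAIC `θ`
  the tree computes that parameter (`ι ↦ {-n_ι}`,
  `AutomorphicRepData.hasArchParameter_of_hasInfinityType_heckeCharacter_glOne`, Clozel 1990 §3.3 /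
  Weil 1956), which is how the route reads off the infinity type of `π(θ)`.
* *Hypotheses and clause 1* are verbatim those of clause (2) of `automorphicInduction_unitaryCharacter_cubic`
  (unitary `θ`; the local regularity datum in place of "does not factor through the norm", see the
  sibling's docstring for why it excludes `θ = ω ∘ N_{E/F}`), so that this fact implies that clause
  (`exists_cuspidal_satake`).  Weaker than printed: ramified finite places, uniqueness of `π(θ)`, the
  converse of the cuspidality criterion and the non-cuspidal case are not asserted.
* `F E : Type` (universe `0`) is forced by the datum, as in the siblings.  Nothing here duplicates a tree
  declaration (`lean search 'cubic_arch|CubicArch'`: nothing; the archimedean clause of a cubic, non-normal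
  induction is stated nowhere else — `Henniart2012_infinityType_of_automorphicInduction` is cyclic-only).

## Sources

* PRIMARY: H. Jacquet, I. I. Piatetski-Shapiro, J. Shalika, *Relèvement cubique non normal*, C. R. Acad.
  Sci. Paris Sér. I 292 (1981) 567–571 (acquisition request acq-06011; the statement "π(θ) = ⊗_v π(τ_v)
  is automorphic" with local components at all places); *Automorphic forms on GL(3) II*, Ann. of Math. 109
  (1979) 213–258, §§13–14 (held as an image scan, OCR request acq-02415).
* S. Gelbart, *Three lectures on the modularity of `ρ̄_{E,3}` and the Langlands reciprocity conjecture*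
  (1997), Thm. 5.3.1, Remark 5.3.1 (e), §7.2 p. 258 (the non-Galois cubic case; `L`-functions).
* G. Henniart, *Induction automorphe globale pour les corps de nombres*, Bull. SMF 140 (2012), §1.12 (shape
  of archimedean automorphic induction on parameters); L. Clozel, *Motifs et formes automorphes* (1990),
  §3.3 (infinity types); A. Borel, H. Jacquet, Corvallis (1979), 4.6 (automorphic representations of
  `GL₁` and Hecke characters).

## References

* [JPSS1981Cubique] * [JacquetPiatetskishapiroShalika1979II] * [Gelbart1997] * [Henniart2012]
* [Clozel1990] * [BorelJacquet1979]
-/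

noncomputable section

open scoped NumberField Polynomial Classical
open NumberField IsDedekindDomain Polynomial Filter Literature.NumberTheory.Automorphic

namespace Literature.NumberTheory.Automorphic

/-- **Automorphic induction of a unitary Hecke character through an arbitrary cubic extension, with
its archimedean components** (Jacquet–Piatetski-Shapiro–Shalika 1981, *Relèvement cubique non normal*,
with *Automorphic forms on GL(3) II* (1979) §§13–14: for `E/F` cubic, not necessarily Galois, and a
unitary character `θ` of `E^× \ 𝔸_E^×`, the representation `⊗_v π(Ind θ)_v` of `GL₃(𝔸_F)`, whose
component at every place `v` — archimedean places included — is the local lift of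
`⊕_{w ∣ v} Ind_{W_{E_w}}^{W_{F_v}} θ_w`, is automorphic, and cuspidal when `θ` does not factor through
`N_{E/F}`; Gelbart 1997, Thm. 5.3.1 with Remark 5.3.1 (e) and §7.2).  Let `E/F` be an extension of
number fields of degree `3`, NOT assumed Galois, `θ` a unitary Hecke character of `E`, and assume the
cuspidality datum of `automorphicInduction_unitaryCharacter_cubic` (places `w ≠ w'` of `E` above one
place of `F`, of the same residue degree, unramified for `θ`, with `θ(ϖ_w) ≠ θ(ϖ_{w'})`).  Then there is
a CUSPIDAL automorphic representation `π` of `GL₃(𝔸_F)` such that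
(1) for almost every finite place `v` of `F`, `π` has a Satake parameter `α` at `v` with
`∏_{a ∈ α} (X - a) = ∏_{w ∣ v} (X^{f(w|v)} - θ(ϖ_w))` (verbatim clause (2) of the sibling fact), and
(2) for every automorphic representation datum `τ` of `GL₁(𝔸_E)` with Satake parameter `{θ(ϖ_w)}` at
almost every `w` and every archimedean parameter `χ` of `τ`, `σ ↦ ∑_{σ' ∣ σ} χ(σ')` is an archimedean
parameter of `π` (the archimedean component of `π(θ)` is induced: Henniart 2012, §1.12 for the shape on
Harish-Chandra parameters; Clozel 1990, §3.3; Borel–Jacquet 1979, 4.6 for `τ ↔ θ`).  Named fact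
(D-0014), weaker than printed (unitary `θ`; local regularity in place of "does not factor through the
norm"; ramified places, uniqueness and the non-cuspidal case not asserted); it implies clause (2) of
`automorphicInduction_unitaryCharacter_cubic` (`exists_cuspidal_satake`).
[cite: JPSS1981Cubique] [cite: JacquetPiatetskishapiroShalika1979II, §§13–14]
[cite: Gelbart1997, Thm. 5.3.1, Remark 5.3.1 (e) and §7.2 p. 258] [cite: Henniart2012, §1.12]
[cite: Clozel1990, §3.3] [cite: BorelJacquet1979, 4.6] -/
def automorphicInduction_unitaryCharacter_cubic_archimedean : Prop :=
  ∀ (F E : Type) [Field F] [NumberField F] [Field E] [NumberField E] [Algebra F E],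
    Module.finrank F E = 3 →
    ∀ (θ : GaloisRepresentations.HeckeCharacter E), θ.IsUnitary →
      ∀ (hF : isCompact_glFiniteIntegralLevel 3 F),
        (∃ (v : HeightOneSpectrum (𝓞 F)) (w w' : HeightOneSpectrum (𝓞 E)), w ≠ w' ∧
            w.under (𝓞 F) = v ∧ w'.under (𝓞 F) = v ∧
            w.asIdeal.inertiaDeg (𝓞 F) = w'.asIdeal.inertiaDeg (𝓞 F) ∧
            θ.IsUnramifiedAt w ∧ θ.IsUnramifiedAt w' ∧
            θ.valueAtUniformizer w ≠ θ.valueAtUniformizer w') →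
          ∃ π : CuspidalAutomorphicRepData 3 F hF,
            (∀ᶠ v : HeightOneSpectrum (𝓞 F) in cofinite, ∃ α : Multiset ℂ,
              π.1.HasSatakeParamAt v α ∧
                satakePolynomial α =
                  ∏ᶠ w ∈ {w : HeightOneSpectrum (𝓞 E) | w.under (𝓞 F) = v},
                    (X ^ w.asIdeal.inertiaDeg (𝓞 F) - C (θ.valueAtUniformizer w))) ∧
            ∀ (hE : isCompact_glFiniteIntegralLevel 1 E) (τ : AutomorphicRepData (AutomorphyDatum.gl 1 E hE)),
              (∀ᶠ w : HeightOneSpectrum (𝓞 E) in cofinite, τ.HasSatakeParamAt w {θ.valueAtUniformizer w}) →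
                ∀ χ : (E →+* ℂ) → Multiset ℂ, τ.HasArchParameter χ →
                  π.1.HasArchParameter fun σ =>
                    ∑ σ' ∈ Finset.univ.filter (fun σ' : E →+* ℂ => σ'.comp (algebraMap F E) = σ), χ σ'

/-- Unfolding lemma for `automorphicInduction_unitaryCharacter_cubic_archimedean`. [folklore] -/
theorem automorphicInduction_unitaryCharacter_cubic_archimedean_iff :
    automorphicInduction_unitaryCharacter_cubic_archimedean ↔
      ∀ (F E : Type) [Field F] [NumberField F] [Field E] [NumberField E] [Algebra F E],
        Module.finrank F E = 3 →
        ∀ (θ : GaloisRepresentations.HeckeCharacter E), θ.IsUnitary →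
          ∀ (hF : isCompact_glFiniteIntegralLevel 3 F),
            (∃ (v : HeightOneSpectrum (𝓞 F)) (w w' : HeightOneSpectrum (𝓞 E)), w ≠ w' ∧
                w.under (𝓞 F) = v ∧ w'.under (𝓞 F) = v ∧
                w.asIdeal.inertiaDeg (𝓞 F) = w'.asIdeal.inertiaDeg (𝓞 F) ∧
                θ.IsUnramifiedAt w ∧ θ.IsUnramifiedAt w' ∧
                θ.valueAtUniformizer w ≠ θ.valueAtUniformizer w') →
              ∃ π : CuspidalAutomorphicRepData 3 F hF,
                (∀ᶠ v : HeightOneSpectrum (𝓞 F) in cofinite, ∃ α : Multiset ℂ,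
                  π.1.HasSatakeParamAt v α ∧
                    satakePolynomial α =
                      ∏ᶠ w ∈ {w : HeightOneSpectrum (𝓞 E) | w.under (𝓞 F) = v},
                        (X ^ w.asIdeal.inertiaDeg (𝓞 F) - C (θ.valueAtUniformizer w))) ∧
                ∀ (hE : isCompact_glFiniteIntegralLevel 1 E)
                  (τ : AutomorphicRepData (AutomorphyDatum.gl 1 E hE)),
                  (∀ᶠ w : HeightOneSpectrum (𝓞 E) in cofinite,
                    τ.HasSatakeParamAt w {θ.valueAtUniformizer w}) →
                    ∀ χ : (E →+* ℂ) → Multiset ℂ, τ.HasArchParameter χ →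
                      π.1.HasArchParameter fun σ =>
                        ∑ σ' ∈ Finset.univ.filter (fun σ' : E →+* ℂ => σ'.comp (algebraMap F E) = σ),
                          χ σ' :=
  Iff.rfl

/-! ### Consequences (proved bookkeeping) -/

section Consequences

variable {F E : Type} [Field F] [NumberField F] [Field E] [NumberField E] [Algebra F E]

/-- **The unramified places**: `automorphicInduction_unitaryCharacter_cubic_archimedean` implies the
cuspidality clause (2) of `automorphicInduction_unitaryCharacter_cubic` (same hypotheses, its clause (1)).
[cite: Gelbart1997, Thm. 5.3.1 and Remark 5.3.1 (e)] -/
theorem automorphicInduction_unitaryCharacter_cubic_archimedean.exists_cuspidal_satake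
    (h : automorphicInduction_unitaryCharacter_cubic_archimedean) (h3 : Module.finrank F E = 3)
    (θ : GaloisRepresentations.HeckeCharacter E) (hθ : θ.IsUnitary)
    (hreg : ∃ (v : HeightOneSpectrum (𝓞 F)) (w w' : HeightOneSpectrum (𝓞 E)), w ≠ w' ∧
      w.under (𝓞 F) = v ∧ w'.under (𝓞 F) = v ∧
      w.asIdeal.inertiaDeg (𝓞 F) = w'.asIdeal.inertiaDeg (𝓞 F) ∧
      θ.IsUnramifiedAt w ∧ θ.IsUnramifiedAt w' ∧
      θ.valueAtUniformizer w ≠ θ.valueAtUniformizer w')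
    (hF : isCompact_glFiniteIntegralLevel 3 F) :
    ∃ π : CuspidalAutomorphicRepData 3 F hF,
      ∀ᶠ v : HeightOneSpectrum (𝓞 F) in cofinite, ∃ α : Multiset ℂ,
        π.1.HasSatakeParamAt v α ∧
          satakePolynomial α =
            ∏ᶠ w ∈ {w : HeightOneSpectrum (𝓞 E) | w.under (𝓞 F) = v},
              (X ^ w.asIdeal.inertiaDeg (𝓞 F) - C (θ.valueAtUniformizer w)) := by
  obtain ⟨π, hπ, -⟩ := h F E h3 θ hθ hF hreg
  exact ⟨π, hπ⟩

/-- **The archimedean places**: the cuspidal induction `π` of the fact carries, for every realisation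
`τ` of `θ` on `GL₁(𝔸_E)` and every archimedean parameter `χ` of `τ`, the induced parameter
`σ ↦ ∑_{σ' ∣ σ} χ(σ')` — the hypothesis `hAI` of `HenniartAutomorphicInductionAssembly` for this `π`.
[cite: JPSS1981Cubique] [cite: Henniart2012, §1.12] -/
theorem automorphicInduction_unitaryCharacter_cubic_archimedean.exists_cuspidal_archParameter
    (h : automorphicInduction_unitaryCharacter_cubic_archimedean) (h3 : Module.finrank F E = 3)
    (θ : GaloisRepresentations.HeckeCharacter E) (hθ : θ.IsUnitary)
    (hreg : ∃ (v : HeightOneSpectrum (𝓞 F)) (w w' : HeightOneSpectrum (𝓞 E)), w ≠ w' ∧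
      w.under (𝓞 F) = v ∧ w'.under (𝓞 F) = v ∧
      w.asIdeal.inertiaDeg (𝓞 F) = w'.asIdeal.inertiaDeg (𝓞 F) ∧
      θ.IsUnramifiedAt w ∧ θ.IsUnramifiedAt w' ∧
      θ.valueAtUniformizer w ≠ θ.valueAtUniformizer w')
    (hF : isCompact_glFiniteIntegralLevel 3 F) {hE : isCompact_glFiniteIntegralLevel 1 E}
    (τ : AutomorphicRepData (AutomorphyDatum.gl 1 E hE))
    (hτ : ∀ᶠ w : HeightOneSpectrum (𝓞 E) in cofinite, τ.HasSatakeParamAt w {θ.valueAtUniformizer w})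
    {χ : (E →+* ℂ) → Multiset ℂ} (hχ : τ.HasArchParameter χ) :
    ∃ π : CuspidalAutomorphicRepData 3 F hF,
      (∀ᶠ v : HeightOneSpectrum (𝓞 F) in cofinite, ∃ α : Multiset ℂ,
        π.1.HasSatakeParamAt v α ∧
          satakePolynomial α =
            ∏ᶠ w ∈ {w : HeightOneSpectrum (𝓞 E) | w.under (𝓞 F) = v},
              (X ^ w.asIdeal.inertiaDeg (𝓞 F) - C (θ.valueAtUniformizer w))) ∧
      π.1.HasArchParameter fun σ =>
        ∑ σ' ∈ Finset.univ.filter (fun σ' : E →+* ℂ => σ'.comp (algebraMap F E) = σ), χ σ' := by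
  obtain ⟨π, hπ, harch⟩ := h F E h3 θ hθ hF hreg
  exact ⟨π, hπ, harch hE τ hτ χ hχ⟩

end Consequences

end Literature.NumberTheory.Automorphic

end
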